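import Mathlib
import Literature.AlgebraicGeometry.Resolution.CobordantGame
import Literature.AlgebraicGeometry.Resolution.CobordantChartCoefficients
import Literature.AlgebraicGeometry.Resolution.CobordantChartPlaneSlice
import Literature.AlgebraicGeometry.Resolution.CobordantTupleGame
import Literature.AlgebraicGeometry.Resolution.FormalCoordinateChange
import Summits.ResolutionOfSingularities.ResolutionOfSingularities.Theorems.WeightedInvariantLocalWeightedDropMonicLinearBlowup
import Summits.ResolutionOfSingularities.ResolutionOfSingularities.Theorems.WeightedInvariantLocalWeightedDropSepTerminalDoublePointsDimAux

/-!
# `WeightedInvariant.LocalWeightedDrop`: linear-centre blow-ups of a DOUBLE POINT `y² + A₀` WITHOUT the vanishing condition —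
# the tame case (`2 ≠ 0`) and the characteristic-`2` case with RE-CENTRING

Crux item stmt-ResolutionOfSingularities-8899 `LocalWeightedDrop` (route `ResolutionOfSingularities/WeightedInvariant`), skeleton v31, residual
stubs W4|₄ / T″|₄ / W4|₅₊ / T″|₅₊ (their `d = 2` slices are games on monic double points `y² + A₀` in `≥ 3` old variables).  [OURS · L1 W4.3,
chain w43, stub worker 4 (gen 4): the move-bricks of the REDUCTION games for double points in every dimension, beyond the terminal layer; the
dimension-generic twins of stub worker 3's `InsepDoublePoint.won_insep_of_pointStep` / `won_dp_of_pointStep` (`m = 1`); NOT a statement of any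
manuscript.]

The brick `won_monic_of_linearBlowup` asks the chart transform to factor as `A₀ ∘ chart_w(c) = s² · B` with `B(0) = 0`, which forces the
singular exceptional points over `γ = 0`.  For a double point `y² + A₀` the condition `B(0) = 0` can be DROPPED:
* `won_dp_of_linearBlowup_of_two_ne_zero` (`2 ≠ 0` in `k`): a singular successor has `y`-linear coefficient `2γ = 0`, so `γ = 0` anyway, and
  the slice at a live old slot is `y² + B|_{x'_{i₀} = 0}`;
* `won_dp_of_linearBlowup_charTwo` (characteristic `2`): singular successors may sit over `γ ≠ 0`, but `(γ + Y)² = γ² + Y²`, so the slice at a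
  live old slot `i₀` (which exists: over `c' = 0` the successor is the unit `γ² + …`) is the RE-CENTRED double point `y² + (γ² + B|_{x'_{i₀} = 0})` —
  the «translation» move of every inseparable resolution game (the position is `A₀` modulo squares).
Both for every weight vector `w` on the old slots with positive entries prime to the characteristic (e.g. `w = 𝟙_S`: point, curve, line, …
centres), every dimension; the caller supplies the factorisation `A₀ ∘ chart_w(c) = s² · B` (i.e. `w`-order of `A₀` at least `2`).
-/

set_option linter.dupNamespace false -- mandated namespace of this single-conjunct summit

namespace Summit.ResolutionOfSingularities.ResolutionOfSingularities.Theorems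

open Literature.AlgebraicGeometry.Resolution
open Literature.AlgebraicGeometry.Resolution.CobordantGame

namespace MonicLinearBlowup

open MvPowerSeries TerminalDoublePointDim

variable {k : Type} [Field k] {m : ℕ}

/-- At the exceptional point `c' = 0` of the old slots every weight-`b` initial value vanishes (`b ≠ 0`). -/
theorem initEval_zero_pt {n : ℕ} (w : Fin n → ℕ) {b : ℕ} (hb : b ≠ 0) (f : MvPowerSeries (Fin n) k) :
    CobordantChart.initEval w (0 : Fin n → k) b f = 0 := by
  classical
  unfold CobordantChart.initEval
  apply finsum_eq_zero_of_forall_eq_zero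
  intro d
  split_ifs with hd
  · have hd0 : d ≠ 0 := by rintro rfl; rw [map_zero] at hd; exact hb hd.symm
    obtain ⟨i, hi⟩ := Finsupp.ne_iff.mp hd0
    rw [Finset.prod_eq_zero (Finset.mem_univ i) (by rw [Pi.zero_apply, zero_pow hi]), mul_zero]
  · rfl

/-- The factorisation datum `B` (`A₀ ∘ chart_w(c) = s² · B`) vanishes at the origin when the old-slot point `c'` is `0`. -/
theorem constantCoeff_factor_eq_zero_of_pt_zero {n : ℕ} (w : Fin n → ℕ) (A₀ : MvPowerSeries (Fin n) k) {B : MvPowerSeries (Fin (n + 1)) k}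
    (hB : subst (CobordantChart.chart w (0 : Fin n → k)) A₀ = X 0 ^ 2 * B) : constantCoeff B = 0 := by
  have h := CobordantChart.coeff_cons_zero_subst_chart w (0 : Fin n → k) (fun _ _ => rfl) A₀ 2
  rw [initEval_zero_pt w two_ne_zero] at h
  rw [← coeff_zero_eq_constantCoeff_apply, ← Finsupp.cons_zero_zero, CobordantChart.coeff_cons_of_eq_X_pow_mul hB 0 0, add_zero]
  exact h

/-- The slice `x'_{i₀} ↦ 0` of `(γ + Y)² + B♮` is `(γ + y)² + (B|_{x'_{i₀} = 0})♯`. -/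
theorem slice_g₀_dp (i₀ : Fin (m + 1)) (γ : k) (B : MvPowerSeries (Fin (m + 1 + 1)) k) :
    subst (fun j : Fin (m + 1 + 1 + 1) => if j = (Fin.castSucc i₀).succ then (0 : MvPowerSeries (Fin (m + 1 + 1)) k)
        else X (Fin.predAbove (Fin.castSucc i₀) j))
      ((C γ + X (Fin.last (m + 1 + 1))) ^ 2 + rename (Fin.succAboveEmb (Fin.last (m + 1 + 1))) B) =
      (C γ + X (Fin.last (m + 1))) ^ 2 + rename (Fin.succAboveEmb (Fin.last (m + 1))) (TupleGame.slice i₀ B) := by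
  have hs := CobordantChartPlaneSlice.hasSubst_slice (R := k) (Fin.castSucc i₀)
  rw [← coe_substAlgHom hs]
  simp only [map_add, map_pow, coe_substAlgHom, subst_C, MultiplicityLift.slice_X_last, MultiplicityLift.slice_rename]

/-- Common core of the two bricks: the move, the transform, and a live OLD slot at every singular successor. -/
theorem exists_liveSlot_of_linearBlowup_dp (p : ℕ) (hp : p.Prime) (k : Type) [Field k] [CharP k p] {m : ℕ}
    (w : Fin (m + 1) → ℕ) (hw : ∀ l, 0 < w l → ¬ p ∣ w l) (A₀ : MvPowerSeries (Fin (m + 1)) k)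
    (hperm : ∀ c : Fin (m + 1) → k, (∀ l, w l = 0 → c l = 0) → ∃ B : MvPowerSeries (Fin (m + 1 + 1)) k,
      subst (CobordantChart.chart w c) A₀ = X 0 ^ 2 * B)
    (g : MvPowerSeries (Fin (m + 1 + 1 + 1)) k)
    (hg : CobordantGame.IsSuccessor k (X (Fin.last (m + 1)) ^ 2 + rename (Fin.succAboveEmb (Fin.last (m + 1))) A₀) X
      (Fin.insertNth (α := fun _ => ℕ) (Fin.last (m + 1)) 1 w) g) :
    ∃ (c : Fin (m + 1) → k) (_ : ∀ l, w l = 0 → c l = 0) (i₀ : Fin (m + 1)) (_ : c i₀ ≠ 0) (B : MvPowerSeries (Fin (m + 1 + 1)) k)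
      (_ : subst (CobordantChart.chart w c) A₀ = X 0 ^ 2 * B) (γ : k)
      (Φ : Fin (m + 1 + 1 + 1) → MvPowerSeries (Fin (m + 1 + 1 + 1)) k) (u : MvPowerSeries (Fin (m + 1 + 1 + 1)) k),
      (∀ j, constantCoeff (Φ j) = 0) ∧ IsUnit (Matrix.det (Matrix.of fun j l => coeff (Finsupp.single l 1) (Φ j))) ∧
      constantCoeff u ≠ 0 ∧
      g = (C γ + X (Fin.last (m + 1 + 1))) ^ 2 + rename (Fin.succAboveEmb (Fin.last (m + 1 + 1))) B ∧
      g = u * subst Φ (subst (fun l : Fin (m + 1 + 1) => (X ((Fin.castSucc i₀).succ.succAbove l) : MvPowerSeries (Fin (m + 1 + 1 + 1)) k))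
        ((C γ + X (Fin.last (m + 1))) ^ 2 + rename (Fin.succAboveEmb (Fin.last (m + 1))) (TupleGame.slice i₀ B))) := by
  classical
  set Wt : Fin (m + 1 + 1) → ℕ := Fin.insertNth (α := fun _ => ℕ) (Fin.last (m + 1)) 1 w with hWtdef
  set P : MvPowerSeries (Fin (m + 1 + 1)) k := X (Fin.last (m + 1)) ^ 2 + rename (Fin.succAboveEmb (Fin.last (m + 1))) A₀ with hP
  have hWtcast : ∀ l, Wt (Fin.castSucc l) = w l := fun l => by rw [hWtdef, insertNth_castSucc]
  obtain ⟨pt, a, ⟨l, hWl, hptl⟩, hfac, hndvd, hsing⟩ := hg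
  have hself : subst (X : Fin (m + 1 + 1) → MvPowerSeries (Fin (m + 1 + 1)) k) P = P := by
    rw [subst_self]; rfl
  rw [hself] at hfac
  set c : Fin (m + 1) → k := fun l => if 0 < w l then pt (Fin.castSucc l) else 0 with hc
  have hc0 : ∀ l, w l = 0 → c l = 0 := fun l hl => by
    rw [hc]; dsimp only; rw [hl, if_neg (lt_irrefl 0)]
  obtain ⟨B₀, hB₀⟩ := hperm c hc0
  have hch := CobordantChart.hasSubst_chart w c hc0
  set B : Fin 2 → MvPowerSeries (Fin (m + 1 + 1)) k := ![B₀, 0] with hB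
  have hBfac : ∀ j : Fin 2, subst (CobordantChart.chart w c) ((![A₀, 0] : Fin 2 → MvPowerSeries (Fin (m + 1)) k) j) =
      X 0 ^ (2 - (j : ℕ)) * B j := by
    intro j
    fin_cases j
    · simpa [hB] using hB₀
    · simp only [hB, Fin.mk_one, Matrix.cons_val_one, Matrix.cons_val_zero]
      rw [← coe_substAlgHom hch, map_zero, mul_zero]
  set γ : k := pt (Fin.last (m + 1)) with hγ
  set g₀ : MvPowerSeries (Fin (m + 1 + 1 + 1)) k := (C γ + X (Fin.last (m + 1 + 1))) ^ 2 +
    ∑ j : Fin 2, rename (Fin.succAboveEmb (Fin.last (m + 1 + 1))) (B j) * (C γ + X (Fin.last (m + 1 + 1))) ^ (j : ℕ) with hg₀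
  have hT : subst (cruxChart k Wt pt) P = X 0 ^ 2 * g₀ := by
    rw [hP, dp_eq_sum, hWtdef, transform_linear w _ pt B hBfac]
  have hndvd₀ : ¬ X 0 ∣ g₀ := not_X_dvd_g₀ γ B
  have hfac₀ := hfac
  rw [hT] at hfac
  obtain ⟨-, hgg⟩ := X_pow_mul_eq_X_pow_mul 0 hfac hndvd₀ hndvd
  subst hgg
  have hg₀' : g₀ = (C γ + X (Fin.last (m + 1 + 1))) ^ 2 + rename (Fin.succAboveEmb (Fin.last (m + 1 + 1))) B₀ := by
    rw [hg₀, Fin.sum_univ_two]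
    simp [hB]
  -- a live OLD slot: otherwise `c = 0`, `B₀(0) = 0`, `γ ≠ 0` and `g₀(0) = γ² ≠ 0`
  have hlive : ∃ i₀ : Fin (m + 1), c i₀ ≠ 0 := by
    by_contra hnone
    push Not at hnone
    have hc00 : c = 0 := funext hnone
    have hB00 : constantCoeff B₀ = 0 := constantCoeff_factor_eq_zero_of_pt_zero w A₀ (by rw [← hc00]; exact hB₀)
    have hγ0 : γ ≠ 0 := by
      rcases Fin.eq_castSucc_or_eq_last l with ⟨i, rfl⟩ | h
      · exfalso
        have hwi : 0 < w i := by rwa [hWtcast] at hWl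
        have := hnone i
        rw [hc] at this
        dsimp only at this
        rw [if_pos hwi] at this
        exact hptl this
      · rw [hγ, ← h]; exact hptl
    have h00 := hsing.1
    rw [hg₀', map_add, constantCoeff_C_add_X_sq, constantCoeff_rename, hB00, add_zero] at h00
    exact hγ0 (pow_eq_zero_iff two_ne_zero |>.mp h00)
  obtain ⟨i₀, hci₀⟩ := hlive
  have hwi₀ : 0 < w i₀ := by
    by_contra h
    exact hci₀ (hc0 i₀ (by omega))
  -- the tame slice at `x'_{i₀}`
  obtain ⟨Cb, hCb⟩ : ∃ Cb : Fin (m + 1 + 1) → k, ∀ l, Cb l = if 0 < Wt l then pt l else 0 := ⟨_, fun _ => rfl⟩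
  have hconvb : ∀ l, Wt l = 0 → Cb l = 0 := fun l hl => by rw [hCb, hl, if_neg (lt_irrefl 0)]
  have hccb : cruxChart k Wt pt = CobordantChart.chart Wt Cb := by
    rw [show Cb = fun l => if 0 < Wt l then pt l else 0 from funext hCb]
    exact CobordantChart.cruxChart_eq_chart Wt pt
  have hCbi : Cb (Fin.castSucc i₀) ≠ 0 := by
    rw [hCb, hWtcast, if_pos hwi₀]
    have := hci₀
    rw [hc] at this
    dsimp only at this
    rwa [if_pos hwi₀] at this
  rw [hccb] at hfac₀
  obtain ⟨Φ₂, u, hΦ₂0, hΦ₂det, hu, hgeq⟩ := tameSlice p hp k (m + 1 + 1) P Wt Cb hconvb a g₀ hfac₀ (Fin.castSucc i₀) hCbi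
    (by rw [hWtcast]; exact hw i₀ hwi₀)
  refine ⟨c, hc0, i₀, hci₀, B₀, hB₀, γ, Φ₂, u, hΦ₂0, hΦ₂det, hu, hg₀', ?_⟩
  rw [← slice_g₀_dp i₀ γ B₀, ← hg₀']
  exact hgeq

end MonicLinearBlowup

open MonicLinearBlowup MvPowerSeries TerminalDoublePointDim in
/-- **LINEAR-CENTRE BLOW-UP OF A TAME DOUBLE POINT** (`2 ≠ 0` in `k`; every dimension, every tame weight vector `w` on the old slots): if
`A₀ ∘ chart_w(c) = s² · B` at every exceptional point of the old slots (NO condition on `B(0)`), then `y² + A₀` is won as soon as every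
SINGULAR slice `y² + B|_{x'_{i₀} = 0}` at a live old slot is won — a singular successor has `y`-coefficient `2γ`, hence lies over `γ = 0`.
[OURS · L1 W4.3] -/
theorem won_dp_of_linearBlowup_of_two_ne_zero (p : ℕ) (hp : p.Prime) (k : Type) [Field k] [CharP k p] (h2 : (2 : k) ≠ 0) {m : ℕ}
    (w : Fin (m + 1) → ℕ) (hw : ∀ l, 0 < w l → ¬ p ∣ w l) (A₀ : MvPowerSeries (Fin (m + 1)) k)
    (hperm : ∀ c : Fin (m + 1) → k, (∀ l, w l = 0 → c l = 0) → ∃ B : MvPowerSeries (Fin (m + 1 + 1)) k,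
      MvPowerSeries.subst (CobordantChart.chart w c) A₀ = MvPowerSeries.X 0 ^ 2 * B)
    (hsucc : ∀ c : Fin (m + 1) → k, (∀ l, w l = 0 → c l = 0) → ∀ i₀ : Fin (m + 1), c i₀ ≠ 0 →
      ∀ B : MvPowerSeries (Fin (m + 1 + 1)) k, MvPowerSeries.subst (CobordantChart.chart w c) A₀ = MvPowerSeries.X 0 ^ 2 * B →
      CobordantGame.IsSingular k (MvPowerSeries.X (Fin.last (m + 1)) ^ 2 +
        MvPowerSeries.rename (Fin.succAboveEmb (Fin.last (m + 1))) (TupleGame.slice i₀ B)) →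
      CobordantGame.Won k (m + 1 + 1) (MvPowerSeries.X (Fin.last (m + 1)) ^ 2 +
        MvPowerSeries.rename (Fin.succAboveEmb (Fin.last (m + 1))) (TupleGame.slice i₀ B))) :
    CobordantGame.Won k (m + 1 + 1) (MvPowerSeries.X (Fin.last (m + 1)) ^ 2 +
      MvPowerSeries.rename (Fin.succAboveEmb (Fin.last (m + 1))) A₀) := by
  classical
  set Wt : Fin (m + 1 + 1) → ℕ := Fin.insertNth (α := fun _ => ℕ) (Fin.last (m + 1)) 1 w with hWtdef
  have hWtlast : Wt (Fin.last (m + 1)) = 1 := by rw [hWtdef, Fin.insertNth_apply_same]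
  have hmove : IsMove k (X : Fin (m + 1 + 1) → MvPowerSeries (Fin (m + 1 + 1)) k) Wt := by
    refine ⟨fun l => constantCoeff_X l, ?_, ⟨Fin.last (m + 1), by rw [hWtlast]; exact one_pos⟩⟩
    rw [← FormalCoordChange.linSubst_one, ConeDichotomy.linMat_linSubst, Matrix.det_one]
    exact isUnit_one
  refine Won.move X Wt hmove fun g hg => ?_
  have hsing : CobordantGame.IsSingular k g := hg.isSingular
  obtain ⟨c, hc0, i₀, hci₀, B, hB, γ, Φ, u, hΦ0, hΦdet, hu, hgB, hgeq⟩ :=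
    exists_liveSlot_of_linearBlowup_dp p hp k w hw A₀ hperm g hg
  -- `γ = 0` from the `y`-linear coefficient `2γ`
  have hγ0 : γ = 0 := by
    have h1 := hsing.2.2 (Fin.last (m + 1 + 1))
    rw [hgB, map_add, SepTerminalDoublePointDim.coeff_single_last_C_add_X_sq, MultiplicityLift.coeff_single_rename_eq_zero _ one_ne_zero,
      add_zero] at h1
    exact (mul_eq_zero.mp h1).resolve_left h2
  rw [hγ0, map_zero, zero_add] at hgeq
  rw [hgeq]
  refine (won_unit_mul_iff hu _).mpr ((won_subst_iff hΦ0 hΦdet _).mpr (won_cyl (Fin.castSucc i₀).succ ?_))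
  by_cases hSs : IsSingular k (X (Fin.last (m + 1)) ^ 2 + rename (Fin.succAboveEmb (Fin.last (m + 1))) (TupleGame.slice i₀ B))
  · exact hsucc c hc0 i₀ hci₀ B hB hSs
  · exact (wonBy_zero_of_not_isSingular (Nat.succ_pos _) hSs).won

open MonicLinearBlowup MvPowerSeries TerminalDoublePointDim in
/-- **LINEAR-CENTRE BLOW-UP OF A CHARACTERISTIC-2 DOUBLE POINT WITH RE-CENTRING** (every dimension, every weight vector `w` on the old slots
with odd positive entries): if `A₀ ∘ chart_w(c) = s² · B` at every exceptional point of the old slots (NO condition on `B(0)`), then `y² + A₀` is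
won as soon as, for every such `c`, live old slot `i₀`, datum `B` and every `γ`, the RE-CENTRED SINGULAR slice `y² + (γ² + B|_{x'_{i₀} = 0})` is won
(`(γ + Y)² = γ² + Y²`).  The translation move of the inseparable double-point games, one dimension-parameter up from
`InsepDoublePoint.won_insep_of_pointStep`. [OURS · L1 W4.3] -/
theorem won_dp_of_linearBlowup_charTwo (k : Type) [Field k] [CharP k 2] {m : ℕ}
    (w : Fin (m + 1) → ℕ) (hw : ∀ l, 0 < w l → ¬ 2 ∣ w l) (A₀ : MvPowerSeries (Fin (m + 1)) k)
    (hperm : ∀ c : Fin (m + 1) → k, (∀ l, w l = 0 → c l = 0) → ∃ B : MvPowerSeries (Fin (m + 1 + 1)) k,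
      MvPowerSeries.subst (CobordantChart.chart w c) A₀ = MvPowerSeries.X 0 ^ 2 * B)
    (hsucc : ∀ c : Fin (m + 1) → k, (∀ l, w l = 0 → c l = 0) → ∀ i₀ : Fin (m + 1), c i₀ ≠ 0 →
      ∀ B : MvPowerSeries (Fin (m + 1 + 1)) k, MvPowerSeries.subst (CobordantChart.chart w c) A₀ = MvPowerSeries.X 0 ^ 2 * B →
      ∀ γ : k, CobordantGame.IsSingular k (MvPowerSeries.X (Fin.last (m + 1)) ^ 2 +
        MvPowerSeries.rename (Fin.succAboveEmb (Fin.last (m + 1))) (MvPowerSeries.C (γ ^ 2) + TupleGame.slice i₀ B)) →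
      CobordantGame.Won k (m + 1 + 1) (MvPowerSeries.X (Fin.last (m + 1)) ^ 2 +
        MvPowerSeries.rename (Fin.succAboveEmb (Fin.last (m + 1))) (MvPowerSeries.C (γ ^ 2) + TupleGame.slice i₀ B))) :
    CobordantGame.Won k (m + 1 + 1) (MvPowerSeries.X (Fin.last (m + 1)) ^ 2 +
      MvPowerSeries.rename (Fin.succAboveEmb (Fin.last (m + 1))) A₀) := by
  classical
  set Wt : Fin (m + 1 + 1) → ℕ := Fin.insertNth (α := fun _ => ℕ) (Fin.last (m + 1)) 1 w with hWtdef
  have hWtlast : Wt (Fin.last (m + 1)) = 1 := by rw [hWtdef, Fin.insertNth_apply_same]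
  have hmove : IsMove k (X : Fin (m + 1 + 1) → MvPowerSeries (Fin (m + 1 + 1)) k) Wt := by
    refine ⟨fun l => constantCoeff_X l, ?_, ⟨Fin.last (m + 1), by rw [hWtlast]; exact one_pos⟩⟩
    rw [← FormalCoordChange.linSubst_one, ConeDichotomy.linMat_linSubst, Matrix.det_one]
    exact isUnit_one
  refine Won.move X Wt hmove fun g hg => ?_
  obtain ⟨c, hc0, i₀, hci₀, B, hB, γ, Φ, u, hΦ0, hΦdet, hu, -, hgeq⟩ :=
    exists_liveSlot_of_linearBlowup_dp 2 Nat.prime_two k w hw A₀ hperm g hg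
  -- in characteristic `2`: `(γ + y)² = γ² + y²`, so the slice is the re-centred double point
  have hsq : ((C γ + X (Fin.last (m + 1))) ^ 2 : MvPowerSeries (Fin (m + 1 + 1)) k) +
      rename (Fin.succAboveEmb (Fin.last (m + 1))) (TupleGame.slice i₀ B) =
      X (Fin.last (m + 1)) ^ 2 + rename (Fin.succAboveEmb (Fin.last (m + 1))) (C (γ ^ 2) + TupleGame.slice i₀ B) := by
    haveI : CharP (MvPowerSeries (Fin (m + 1 + 1)) k) 2 :=
      charP_of_injective_algebraMap (C_injective (σ := Fin (m + 1 + 1)) (R := k)) 2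
    rw [add_pow_two, map_add, rename_C, map_pow, mul_assoc, show (2 : MvPowerSeries (Fin (m + 1 + 1)) k) = 0 from CharTwo.two_eq_zero,
      zero_mul, add_zero]
    ring
  rw [hsq] at hgeq
  rw [hgeq]
  refine (won_unit_mul_iff hu _).mpr ((won_subst_iff hΦ0 hΦdet _).mpr (won_cyl (Fin.castSucc i₀).succ ?_))
  by_cases hSs : IsSingular k (X (Fin.last (m + 1)) ^ 2 + rename (Fin.succAboveEmb (Fin.last (m + 1))) (C (γ ^ 2) + TupleGame.slice i₀ B))
  · exact hsucc c hc0 i₀ hci₀ B hB γ hSs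
  · exact (wonBy_zero_of_not_isSingular (Nat.succ_pos _) hSs).won

end Summit.ResolutionOfSingularities.ResolutionOfSingularities.Theorems
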